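/-
Speedrun cell sr-mbsolver — LEAN team (lit-4 gen-4), D-19 r81 (f) "T3": VALIDITY OF THE ENTROPY (weak-monotonicity)
TANGENT CUTS of lever family `ent` (op-08, `HOME/op/entropy-cuts.md` §2 and §4 "LEMMA (sufficient for validity)";
lit-1 `HOME/sr-mbsolver-lit-1/lean/T3-PLAN.md`).
HONEST FRAMING: first certified bounds; not a superconductivity verdict; every number certified or labelled float.

WHAT THIS GIVES. A certified entropy cut is a pair of RATIONAL Hermitian matrices `X̃` (on the `k`-site window, index
`m × n`: `m` = the traced-out first site, `n` = the remaining `k − 1` sites) and `Ỹ` (on `n`) together with an interval-arithmetic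
certificate of the finite matrix inequality `exp Ỹ ⪰ Tr₁ exp X̃`. `entropyCut_valid` is op-08's sufficiency lemma: for every
density matrix `ρ` on `m × n` whose conditional entropy is non-negative, `0 ≤ S(ρ) − S(Tr₁ ρ)` (the weak-monotonicity /
translation-invariance consequence, `Literature.InformationTheory.Entropy.entropy_increment_nonneg_of_weak_monotonicity`), the
LINEAR row `Re Tr(ρ X̃) ≤ Re Tr(Tr₁ρ · Ỹ)` holds. The deep input is the named Literature fact
`relEntropy_partialTrace_le` (Lindblad 1975, Lemma 2), taken as a hypothesis exactly as the row instances do.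

PROOF (op-08 §4 / T3-PLAN steps 1–7). `σ := exp X̃ / Tr exp X̃` is a faithful density matrix with faithful marginals
(`posDef_cfc_of_pos`, `posDef_traceLeft/Right`); the unfolded Lindblad inequality
(`entropy_increment_le_tangent_of_relEntropy_partialTrace_le`, lit-3) reads
`S(ρ) − S(Tr₁ρ) ≤ −Re Tr(ρ log σ) + Re Tr(Tr₁ρ · log Tr₁σ)`; `log σ = X̃ − log c · 1` and `log Tr₁σ = log Tr₁ exp X̃ − log c · 1`
(functional calculus on Hermitian matrices), the two `log c` cancel because `Tr ρ = Tr Tr₁ρ = 1`, so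
`Re Tr(ρ X̃) ≤ Re Tr(Tr₁ρ · log Tr₁ exp X̃)` (`re_trace_mul_le_of_entropy_increment_nonneg`, a Gibbs-type bound); finally the
logarithm is matrix monotone (`Literature.LinearAlgebra.Matrix.posSemidef_cfc_log_sub_cfc_log`, lit-1), so `exp Ỹ ⪰ Tr₁ exp X̃`
gives `Ỹ ⪰ log Tr₁ exp X̃`, and `Re Tr(Tr₁ρ · (Ỹ − log Tr₁ exp X̃)) ≥ 0` by the positivity of the trace pairing.
[cite: FawziFawziScalet2024Entropy, §2 (convexity of the weak-monotonicity region) and Thm 4.1]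
[cite: Lindblad1975, Lemma 2 p.149] [cite: NielsenChuang2010, Thm 11.17] [cite: Bernstein2009, Prop. 8.6.13 xviii)]
-/
import Mathlib.Analysis.Matrix.Order
import Literature.LinearAlgebra.Matrix.LogLoewnerMonotone
import Literature.LinearAlgebra.Matrix.PosSemidefTrace
import Literature.InformationTheory.Entropy.VonNeumannEntropyInequalities
import Literature.MathematicalPhysics.QuantumLattice.KroneckerPartialTrace
import HarnessLib

noncomputable section

open Matrix
open scoped ComplexOrder MatrixOrder
open Literature.Computability.QuantumComplexity (traceLeft traceRight IsDensity trace_traceLeft trace_traceRight)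
open Literature.InformationTheory.Entropy
open Literature.MathematicalPhysics.QuantumLattice (posSemidef_traceLeft posSemidef_traceRight traceLeft_smul
  traceRight_smul)

namespace Summit.Ventures.CertifiedManyBodySolver.Entropy

/-! ### Faithful states have faithful marginals -/

section PartialTracePosDef

variable {m n : Type*} [Fintype m] [Fintype n] [DecidableEq m] [DecidableEq n]

omit [Fintype n] [DecidableEq m] [DecidableEq n] in
/-- `Tr₁ E = Σ_a E|_{{a} × n}`: the partial trace over the first factor is the sum of the principal
`n × n` blocks. [cite: NielsenChuang2010, §2.4.3 eq. (2.178)] -/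
theorem traceLeft_eq_sum_submatrix (E : Matrix (m × n) (m × n) ℂ) :
    traceLeft E = ∑ a, E.submatrix (Prod.mk a) (Prod.mk a) := by
  ext b b'
  simp [Matrix.sum_apply]

omit [Fintype m] [DecidableEq m] [DecidableEq n] in
/-- `Tr₂ E = Σ_b E|_{m × {b}}`. [cite: NielsenChuang2010, §2.4.3 eq. (2.178)] -/
theorem traceRight_eq_sum_submatrix (E : Matrix (m × n) (m × n) ℂ) :
    traceRight E = ∑ b, E.submatrix (fun a => (a, b)) (fun a => (a, b)) := by
  ext a a'
  simp [Matrix.sum_apply]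

omit [Fintype n] [DecidableEq m] [DecidableEq n] in
/-- A positive definite matrix on `m × n` (`m` non-empty) has a positive definite `Tr₁`-marginal.
[cite: NielsenChuang2010, §2.4.3] -/
theorem posDef_traceLeft [Nonempty m] {E : Matrix (m × n) (m × n) ℂ} (hE : E.PosDef) :
    (traceLeft E).PosDef := by
  rw [traceLeft_eq_sum_submatrix]
  exact Matrix.posDef_sum Finset.univ_nonempty fun a _ => hE.submatrix (Prod.mk_right_injective a)

omit [Fintype m] [DecidableEq m] [DecidableEq n] in
/-- A positive definite matrix on `m × n` (`n` non-empty) has a positive definite `Tr₂`-marginal.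
[cite: NielsenChuang2010, §2.4.3] -/
theorem posDef_traceRight [Nonempty n] {E : Matrix (m × n) (m × n) ℂ} (hE : E.PosDef) :
    (traceRight E).PosDef := by
  rw [traceRight_eq_sum_submatrix]
  exact Matrix.posDef_sum Finset.univ_nonempty fun b _ => hE.submatrix (Prod.mk_left_injective b)

end PartialTracePosDef

/-! ### Functional calculus on Hermitian matrices: `exp`, `log`, normalisation -/

section CFC

variable {k : Type*} [Fintype k] [DecidableEq k]

omit [Fintype k] [DecidableEq k] in
/-- Real scalars act on complex matrices through `ℝ ⊂ ℂ`: `r • M = (r : ℂ) • M`. [folklore] -/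
theorem real_smul_eq_coe_smul (r : ℝ) (M : Matrix k k ℂ) : r • M = (r : ℂ) • M := by
  ext i j
  simp [Matrix.smul_apply, Complex.real_smul]

/-- `f(X)` is positive definite for a Hermitian matrix `X` and an everywhere-positive real function `f`
(in particular `exp X ≻ 0`). [cite: Bernstein2009, Prop. 11.2.8 vii) p.650] -/
theorem posDef_cfc_of_pos {X : Matrix k k ℂ} (hX : X.IsHermitian) {f : ℝ → ℝ} (hf : ∀ x, 0 < f x) :
    (cfc f X).PosDef := by
  have hXsa : IsSelfAdjoint X := hX
  have hcont : ContinuousOn f (spectrum ℝ X) := (Matrix.finite_real_spectrum).continuousOn _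
  have h0 : (0 : Matrix k k ℂ) ≤ cfc f X := cfc_nonneg fun x _ => (hf x).le
  have hpsd : (cfc f X).PosSemidef := Matrix.nonneg_iff_posSemidef.mp h0
  have hunit : IsUnit (cfc f X) := (isUnit_cfc_iff f X hcont hXsa).mpr fun x _ => (hf x).ne'
  exact hpsd.posDef_iff_isUnit.mpr hunit

/-- `log (exp Y) = Y` for Hermitian `Y`. [cite: Bernstein2009, Thm 11.5.2 ii) p.659] -/
theorem cfc_log_cfc_exp {Y : Matrix k k ℂ} (hY : Y.IsHermitian) : cfc Real.log (cfc Real.exp Y) = Y := by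
  have hYsa : IsSelfAdjoint Y := hY
  have hcont : ContinuousOn Real.log (Real.exp '' spectrum ℝ Y) :=
    ((Matrix.finite_real_spectrum).image _).continuousOn _
  rw [← cfc_comp' Real.log Real.exp Y hcont]
  have : (fun x => Real.log (Real.exp x)) = fun x => x := funext Real.log_exp
  rw [this, cfc_id' ℝ Y]

/-- `log (exp X / c) = X − (log c) · 1` for Hermitian `X` and `c > 0`. [cite: Bernstein2009, Thm 11.5.2 ii) p.659] -/
theorem cfc_log_cfc_exp_div {X : Matrix k k ℂ} (hX : X.IsHermitian) {c : ℝ} (hc : 0 < c) :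
    cfc Real.log (cfc (fun t => Real.exp t / c) X) = X - algebraMap ℝ (Matrix k k ℂ) (Real.log c) := by
  have hXsa : IsSelfAdjoint X := hX
  have hcont : ContinuousOn Real.log ((fun t => Real.exp t / c) '' spectrum ℝ X) :=
    ((Matrix.finite_real_spectrum).image _).continuousOn _
  rw [← cfc_comp' Real.log (fun t => Real.exp t / c) X hcont]
  have : (fun t => Real.log (Real.exp t / c)) = fun t => t - Real.log c := by
    funext t
    rw [Real.log_div (Real.exp_pos t).ne' hc.ne', Real.log_exp]
  rw [this, cfc_sub (fun t : ℝ => t) (fun _ => Real.log c) X, cfc_id' ℝ X, cfc_const (Real.log c) X]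

/-- `log (c⁻¹ T) = log T − (log c) · 1` for positive definite `T` and `c > 0`
(the spectrum of `T` is positive, where `log (c⁻¹ t) = log t − log c`). [cite: Bernstein2009, Prop. 11.2.9 iii) p.653] -/
theorem cfc_log_smul_of_posDef {T : Matrix k k ℂ} (hT : T.PosDef) {c : ℝ} (hc : 0 < c) :
    cfc Real.log (((c⁻¹ : ℝ) : ℂ) • T) = cfc Real.log T - algebraMap ℝ (Matrix k k ℂ) (Real.log c) := by
  have hTsa : IsSelfAdjoint T := hT.1
  have h1 : ((c⁻¹ : ℝ) : ℂ) • T = cfc (fun t => c⁻¹ * t) T := by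
    rw [cfc_const_mul c⁻¹ (fun t : ℝ => t) T, cfc_id' ℝ T, real_smul_eq_coe_smul]
  have hcont : ContinuousOn Real.log ((fun t => c⁻¹ * t) '' spectrum ℝ T) :=
    ((Matrix.finite_real_spectrum).image _).continuousOn _
  rw [h1, ← cfc_comp' Real.log (fun t => c⁻¹ * t) T hcont]
  have hpos : ∀ t ∈ spectrum ℝ T, 0 < t := by
    intro t ht
    rw [hT.1.spectrum_real_eq_range_eigenvalues] at ht
    obtain ⟨i, rfl⟩ := ht
    exact hT.eigenvalues_pos i
  have heq : (spectrum ℝ T).EqOn (fun t => Real.log (c⁻¹ * t)) (fun t => Real.log t - Real.log c) := by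
    intro t ht
    simp only
    rw [Real.log_mul (inv_pos.mpr hc).ne' (hpos t ht).ne', Real.log_inv]
    ring
  rw [cfc_congr (hfg := heq), cfc_sub Real.log (fun _ => Real.log c) T ((Matrix.finite_real_spectrum).continuousOn _),
    cfc_const (Real.log c) T]

/-- `Re Tr(A (B − r · 1)) = Re Tr(A B) − r` for a matrix `A` of trace one. [folklore] -/
theorem re_trace_mul_sub_algebraMap {A B : Matrix k k ℂ} (hA : A.trace = 1) (r : ℝ) :
    ((A * (B - algebraMap ℝ (Matrix k k ℂ) r)).trace).re = ((A * B).trace).re - r := by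
  rw [Algebra.algebraMap_eq_smul_one, mul_sub, Matrix.mul_smul, mul_one, Matrix.trace_sub, Matrix.trace_smul, hA,
    Complex.sub_re]
  simp

end CFC

/-! ### The Gibbs-type bound and the validity of a certified entropy cut -/

section Cut

/-- **Gibbs-type bound from the non-negative conditional entropy.** For a density matrix `ρ` on `ℋ_m ⊗ ℋ_n`
with `0 ≤ S(ρ) − S(Tr₁ρ)` and any Hermitian `X`: `Re Tr(ρ X) ≤ Re Tr(Tr₁ρ · log Tr₁ exp X)` — the unfolded
Lindblad inequality at the faithful state `σ = exp X / Tr exp X` (op-08 entropy-cuts.md §2: `T_σ(ρ) ≥ h_k(ρ) ≥ 0`).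
[cite: Lindblad1975, Lemma 2 p.149] [cite: FawziFawziScalet2024Entropy, §2] -/
theorem re_trace_mul_le_of_entropy_increment_nonneg (hDPI : relEntropy_partialTrace_le)
    {m n : Type} [Fintype m] [Fintype n] [DecidableEq m] [DecidableEq n]
    (ρ : Matrix (m × n) (m × n) ℂ) (hρ : IsDensity ρ)
    (hinc : 0 ≤ vonNeumannEntropy ρ - vonNeumannEntropy (traceLeft ρ))
    {X : Matrix (m × n) (m × n) ℂ} (hX : X.IsHermitian) :
    ((ρ * X).trace).re ≤ ((traceLeft ρ * cfc Real.log (traceLeft (cfc Real.exp X))).trace).re := by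
  -- the index types are non-empty because `Tr ρ = 1`
  have hne : Nonempty (m × n) := by
    by_contra h
    rw [not_nonempty_iff] at h
    have h0 : ρ.trace = 0 := by simp [Matrix.trace]
    rw [hρ.2] at h0
    exact one_ne_zero h0
  obtain ⟨⟨a₀, b₀⟩⟩ := hne
  haveI : Nonempty m := ⟨a₀⟩
  haveI : Nonempty n := ⟨b₀⟩
  -- `E = exp X ≻ 0`, `c = Tr E > 0`
  set E : Matrix (m × n) (m × n) ℂ := cfc Real.exp X with hEdef
  have hEpd : E.PosDef := posDef_cfc_of_pos hX Real.exp_pos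
  have htr : (0 : ℂ) < E.trace := hEpd.trace_pos
  obtain ⟨hc, him⟩ := Complex.pos_iff.mp htr
  set c : ℝ := E.trace.re with hcdef
  have hEtr : E.trace = (c : ℂ) := Complex.ext (by simp [c]) (by simp [← him])
  -- the faithful density `σ = exp X / c`
  set σ : Matrix (m × n) (m × n) ℂ := cfc (fun t => Real.exp t / c) X with hσdef
  have hσE : σ = ((c⁻¹ : ℝ) : ℂ) • E := by
    have hfun : (fun t => Real.exp t / c) = fun t => c⁻¹ * Real.exp t := by
      funext t
      rw [div_eq_inv_mul]
    rw [hσdef, hfun, cfc_const_mul c⁻¹ Real.exp X, real_smul_eq_coe_smul]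
  have hσpd : σ.PosDef := posDef_cfc_of_pos hX fun t => div_pos (Real.exp_pos t) hc
  have hσtr : σ.trace = 1 := by
    rw [hσE, Matrix.trace_smul, hEtr, smul_eq_mul, ← Complex.ofReal_mul, inv_mul_cancel₀ hc.ne',
      Complex.ofReal_one]
  have hσ : IsDensity σ := ⟨hσpd.posSemidef, hσtr⟩
  -- the unfolded Lindblad inequality at `σ`
  have hT2 := entropy_increment_le_tangent_of_relEntropy_partialTrace_le hDPI ρ σ hρ hσ hσpd
    (posDef_traceLeft hσpd) (posDef_traceRight hσpd)
  -- the logarithms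
  have hlogσ : cfc Real.log σ = X - algebraMap ℝ _ (Real.log c) := cfc_log_cfc_exp_div hX hc
  have hTpd : (traceLeft E).PosDef := posDef_traceLeft hEpd
  have hlogσL : cfc Real.log (traceLeft σ) = cfc Real.log (traceLeft E) - algebraMap ℝ _ (Real.log c) := by
    rw [hσE, traceLeft_smul, cfc_log_smul_of_posDef hTpd hc]
  have hρL : (traceLeft ρ).trace = 1 := by rw [trace_traceLeft, hρ.2]
  rw [hlogσ, re_trace_mul_sub_algebraMap hρ.2, hlogσL, re_trace_mul_sub_algebraMap hρL] at hT2
  linarith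

/-- **T3 — validity of a certified entropy cut (op-08 entropy-cuts.md §4, LEMMA).** For a density matrix
`ρ` on `ℋ_m ⊗ ℋ_n` with non-negative conditional entropy `0 ≤ S(ρ) − S(Tr₁ρ)`, Hermitian `X` (on `m × n`) and
`Y` (on `n`) with `exp Y ⪰ Tr₁ exp X`, the linear row `Re Tr(ρ X) ≤ Re Tr(Tr₁ρ · Y)` holds. The monotonicity of
the relative entropy under the partial trace enters as the named Literature fact `relEntropy_partialTrace_le`
(hypothesis `hDPI`), as in the row instances. [cite: FawziFawziScalet2024Entropy, §2 and Thm 4.1]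
[cite: Lindblad1975, Lemma 2 p.149] [cite: Bernstein2009, Prop. 8.6.13 xviii) p.464] -/
theorem entropyCut_valid (hDPI : relEntropy_partialTrace_le)
    {m n : Type} [Fintype m] [Fintype n] [DecidableEq m] [DecidableEq n]
    (ρ : Matrix (m × n) (m × n) ℂ) (hρ : IsDensity ρ)
    (hinc : 0 ≤ vonNeumannEntropy ρ - vonNeumannEntropy (traceLeft ρ))
    (X : Matrix (m × n) (m × n) ℂ) (Y : Matrix n n ℂ) (hX : X.IsHermitian) (hY : Y.IsHermitian)
    (hlem : (cfc Real.exp Y - traceLeft (cfc Real.exp X)).PosSemidef) :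
    ((ρ * X).trace).re ≤ ((traceLeft ρ * Y).trace).re := by
  have h1 := re_trace_mul_le_of_entropy_increment_nonneg hDPI ρ hρ hinc hX
  -- non-emptiness (for the positive definiteness of the marginal of `exp X`)
  have hne : Nonempty (m × n) := by
    by_contra h
    rw [not_nonempty_iff] at h
    have h0 : ρ.trace = 0 := by simp [Matrix.trace]
    rw [hρ.2] at h0
    exact one_ne_zero h0
  obtain ⟨⟨a₀, b₀⟩⟩ := hne
  haveI : Nonempty m := ⟨a₀⟩
  -- `Y ⪰ log Tr₁ exp X` by the operator monotonicity of the logarithm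
  have hTpd : (traceLeft (cfc Real.exp X)).PosDef := posDef_traceLeft (posDef_cfc_of_pos hX Real.exp_pos)
  have hlog : (Y - cfc Real.log (traceLeft (cfc Real.exp X))).PosSemidef := by
    have h := Literature.LinearAlgebra.Matrix.posSemidef_cfc_log_sub_cfc_log hTpd hlem
    rwa [cfc_log_cfc_exp hY] at h
  -- positivity of the trace pairing with `Tr₁ ρ ⪰ 0`
  have hpair := Literature.LinearAlgebra.Matrix.re_trace_mul_nonneg_of_posSemidef (posSemidef_traceLeft hρ.1) hlog
  rw [mul_sub, Matrix.trace_sub, Complex.sub_re] at hpair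
  linarith

end Cut

end Summit.Ventures.CertifiedManyBodySolver.Entropy
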